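import Mathlib
import Summits.NavierStokesRegularity.NavierStokesRegularity.Theorems.EulerZoomLiouvillePowerGaugeEulerLiouvilleSelfSimilarBernoulliBounded
import HarnessLib

/-!
# PAST-EXACT self-similar members whose `C²` profile has a BOUNDED BERNOULLI FUNCTION and an UNPRESSURISED far field are trivial
# (crux `EulerZoomLiouville.PowerGaugeEulerLiouville` = stmt-NavierStokesRegularity-19832, line `birth`; the PAST/SHIFTED twin of the LEAD's
# `Loc.selfSimilar_ae_eq_zero_of_boundedBernoulliC2_profile`, …SelfSimilarBernoulliBounded p629868)

Route №10 `EulerZoomLiouville` (NavierStokesRegularity); width seat ns-ezl-w5 g0.  The LEAD's second dynamical lever on THE ONE STATEMENT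
(ns-typeII-p2 g11, `Loc.curl_eq_zero_of_bernoulli_le_of_pressure_le`): a `C²` in-window CIV (3.3) profile `(U, P)` (`0 < γ < ½`) whose
self-similar Bernoulli function `ℋ = ½|γy + U|² + P + ½γ(γ−1)|y|²` is BOUNDED ABOVE and whose pressure is UNPRESSURISED far out
(`P(y) ≤ ε‖y‖²` for `‖y‖ ≥ R₀`, `ε < ½γ(1−γ)`) is irrotational.  Its member form in the tree is the WHOLE-SLAB CENTRED one.  This file supplies the
PAST-EXACT / SHIFTED form by the wrapper the tree uses for every other `C²` past stratum (`…SelfSimilarPastPiercingSpheres`,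
`…SelfSimilarBernoulliPiercing` §Past): a class member `(u, p, H, c)` (`0 < ρ ≤ ½`) exactly self-similar about `(T, x₀)` on a past sub-slab
`τ < T₁` (`T₁ ≤ 0`, `T₁ ≤ T`; arbitrary on `[T₁, 0)`) with a `C²` velocity profile `V` —

1. profile dictionary: the origin-centred extension from the far past gives a CIV (3.3) profile `(V, P')` (`Past.exists_isSelfSimilarEulerProfile`);
2. the hypothesis, quantified over ALL classical pressures `P'` of `V` exactly as the LEAD's v51 predicate `HasBoundedBernoulliUnpressurised ρ V`,
   gives the Bernoulli bound and the unpressurised far field for THIS `P'`, and the LEAD's lever gives `curl V ≡ 0`;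
3. the irrotational past stratum `Past.profile_eq_zero_of_irrotationalC2` / `Past.ae_eq_zero_of_profile_eq_zero` makes the member vanish on the
   WHOLE slab.

* `Past.profile_eq_zero_of_boundedBernoulliC2` — profile level (`V = 0`);
* `Past.selfSimilar_ae_eq_zero_of_boundedBernoulliC2_profile_past` — MEMBER LEVEL, crux hypotheses verbatim (`0 < ρ ≤ ½`) + past-exact
  self-similarity (`IsPastSelfSimilar ρ T T₁ x₀ u p V P` unfolded) + `ContDiff ℝ 2 V` + `HasBoundedBernoulliUnpressurised ρ V` (unfolded) ⇒
  `u = 0` a.e. on `(−∞,0) × ℝ³`.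

Intended wiring (LEAD's call): the past-exact `C²` strata gain the disjunct `HasBoundedBernoulliUnpressurised ρ V` next to `HasBernoulliPiercing ρ V`.

WHAT THIS IS NOT: not NS, not E — a classical sub-stratum `--supports` stmt-19832 on the MODEL lattice (19832 is a crux CLASS of E/NS strata, not
NS regularity); the registered needle (vortical and Bernoulli-high through every large sphere, with `sup ℋ = +∞` or a pressurised far field), the
weak class and the nowhere-self-similar members stay OPEN. [folklore; ConstantinIgnatovaVicol2026Putative §3.4.1 (3.29)–(3.31), §3.5]
-/

noncomputable section

-- flat `Theorems/<Route><Decl>…` files of one crux share the namespace of the crux (tree convention: `Summit.<S>.<S>.…`)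
set_option linter.dupNamespace false

open MeasureTheory Set Filter Topology Metric Function InnerProductSpace TopologicalSpace
open scoped RealInnerProductSpace NNReal ENNReal ContDiff

namespace Summit.NavierStokesRegularity.NavierStokesRegularity.Theorems.PowerGaugeEulerLiouville.Past

open Literature.Analysis Literature.Analysis.FunctionSpaces Literature.Analysis.FluidPDE

variable {ρ T T₁ : ℝ} {x₀ : EuclideanSpace ℝ (Fin 3)}
  {u : ℝ → EuclideanSpace ℝ (Fin 3) → EuclideanSpace ℝ (Fin 3)} {p : ℝ → EuclideanSpace ℝ (Fin 3) → ℝ}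
  {H : ℝ → EuclideanSpace ℝ (Fin 3) → EuclideanSpace ℝ (Fin 3) →L[ℝ] EuclideanSpace ℝ (Fin 3)} {c : ℝ≥0}
  {V : EuclideanSpace ℝ (Fin 3) → EuclideanSpace ℝ (Fin 3)} {P : EuclideanSpace ℝ (Fin 3) → ℝ}

/-! ### Profile level: `V = 0` -/

/-- **Past-exact member, `C²` profile with BOUNDED BERNOULLI FUNCTION and UNPRESSURISED far field: the profile is ZERO** (`0 < ρ ≤ ½`; exact
self-similarity about `(T, x₀)` for `τ < T₁ ≤ min 0 T`): the extension from the far past supplies a CIV (3.3) profile `(V, P')`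
(`Past.exists_isSelfSimilarEulerProfile`), the hypothesis (over all classical pressures) gives `ℋ ≤ M̄` and `P' ≤ ε‖y‖²` far out for it, the LEAD's
`Loc.curl_eq_zero_of_bernoulli_le_of_pressure_le` gives `curl V ≡ 0`, and `Past.profile_eq_zero_of_irrotationalC2` finishes. [folklore] -/
theorem profile_eq_zero_of_boundedBernoulliC2 (hρ : 0 < ρ) (hρh : ρ ≤ 1 / 2) (hT₁ : T₁ ≤ 0) (hTT₁ : T₁ ≤ T)
    (hsol : IsDistributionalNSSolutionOn (slab (EuclideanSpace ℝ (Fin 3)) (Iio 0) isOpen_Iio) 0 0 u p)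
    (hA : ∀ a : ℝ, 0 < a → ENNReal.ofReal (a ^ (2 * ρ)) *
      cknA a (0 : ℝ × EuclideanSpace ℝ (Fin 3)) u ≤ (c : ℝ≥0∞))
    (hu : ∀ τ : ℝ, τ < T₁ → u τ = fun x => selfSimilarCollapse (1 / (2 + ρ)) T V τ (x - x₀))
    (hp : ∀ τ : ℝ, τ < T₁ → p τ = fun x => selfSimilarCollapsePressure (1 / (2 + ρ)) T P τ (x - x₀))
    (hV : ContDiff ℝ 2 V)
    (hB : ∀ P' : EuclideanSpace ℝ (Fin 3) → ℝ, IsSelfSimilarEulerProfile (1 / (2 + ρ)) 0 V P' →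
      (∃ Mb : ℝ, ∀ y, selfSimilarBernoulli (1 / (2 + ρ)) 0 V P' y ≤ Mb) ∧
      (∃ ε R₀ : ℝ, ε < (1 / (2 + ρ)) * (1 - 1 / (2 + ρ)) / 2 ∧
        ∀ y : EuclideanSpace ℝ (Fin 3), R₀ ≤ ‖y‖ → P' y ≤ ε * ‖y‖ ^ 2)) : V = 0 := by
  -- adapted from `Past.profile_eq_zero_of_piercingBernoulliC2` (…SelfSimilarBernoulliPiercing)
  have h2ρ : (0 : ℝ) < 2 + ρ := by linarith
  have hγ : (0 : ℝ) < 1 / (2 + ρ) := one_div_pos.2 h2ρ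
  have hγ2 : 1 / (2 + ρ) < 1 / 2 := one_div_lt_one_div_of_lt two_pos (by linarith)
  obtain ⟨P', hprof⟩ := exists_isSelfSimilarEulerProfile hρ hT₁ hTT₁ hsol hu hp hV
  obtain ⟨⟨Mb, hMb⟩, ⟨ε, R₀, hε, hPε⟩⟩ := hB P' hprof
  have hcurl : ∀ x, curl V x = 0 := fun x =>
    Loc.curl_eq_zero_of_bernoulli_le_of_pressure_le hprof hγ hγ2 hMb hε hPε x
  exact profile_eq_zero_of_irrotationalC2 hρ hρh hT₁ hTT₁ hsol hA hu hp hV hcurl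

/-! ### Member level: crux hypotheses verbatim -/

/-- **PAST-EXACT MEMBER WHOSE `C²` PROFILE HAS A BOUNDED BERNOULLI FUNCTION AND AN UNPRESSURISED FAR FIELD IS TRIVIAL** (crux hypotheses verbatim,
`0 < ρ ≤ ½`, exact self-similarity about `(T, x₀)` for `τ < T₁`, `T₁ ≤ 0`, `T₁ ≤ T`; `V ∈ C²`; for every classical pressure `P'` of `V`:
`sup ℋ < ∞` and `P'(y) ≤ ε‖y‖²` beyond some radius with `ε < ½γ(1−γ)`, `γ = 1/(2+ρ)`).  The past twin of
`Loc.selfSimilar_ae_eq_zero_of_boundedBernoulliC2_profile`; binder shape `IsPastSelfSimilar ρ T T₁ x₀ u p V P` + `ContDiff ℝ 2 V` +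
`HasBoundedBernoulliUnpressurised ρ V` of the lead skeleton v51. [folklore] -/
theorem selfSimilar_ae_eq_zero_of_boundedBernoulliC2_profile_past (hρ : 0 < ρ) (hρh : ρ ≤ 1 / 2) (hT₁ : T₁ ≤ 0)
    (hTT₁ : T₁ ≤ T) (x₀ : EuclideanSpace ℝ (Fin 3))
    (hsw : IsSuitableWeakSolutionOn (slab (EuclideanSpace ℝ (Fin 3)) (Iio 0) isOpen_Iio) 0 0 u p)
    (hH : HasWeakSpatialGradientOn (slab (EuclideanSpace ℝ (Fin 3)) (Iio 0) isOpen_Iio) u H)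
    (hgauge : ∀ a : ℝ, 0 < a →
      ENNReal.ofReal (a ^ (2 * ρ)) * cknA a (0 : ℝ × EuclideanSpace ℝ (Fin 3)) u +
          ENNReal.ofReal (a ^ ρ) * cknE a (0 : ℝ × EuclideanSpace ℝ (Fin 3)) H +
        ENNReal.ofReal (a ^ (2 * ρ)) * cknD a (0 : ℝ × EuclideanSpace ℝ (Fin 3)) p ≤ (c : ℝ≥0∞))
    (hu : ∀ τ : ℝ, τ < T₁ → u τ = fun x => selfSimilarCollapse (1 / (2 + ρ)) T V τ (x - x₀))
    (hp : ∀ τ : ℝ, τ < T₁ → p τ = fun x => selfSimilarCollapsePressure (1 / (2 + ρ)) T P τ (x - x₀))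
    (hV : ContDiff ℝ 2 V)
    (hB : ∀ P' : EuclideanSpace ℝ (Fin 3) → ℝ, IsSelfSimilarEulerProfile (1 / (2 + ρ)) 0 V P' →
      (∃ Mb : ℝ, ∀ y, selfSimilarBernoulli (1 / (2 + ρ)) 0 V P' y ≤ Mb) ∧
      (∃ ε R₀ : ℝ, ε < (1 / (2 + ρ)) * (1 - 1 / (2 + ρ)) / 2 ∧
        ∀ y : EuclideanSpace ℝ (Fin 3), R₀ ≤ ‖y‖ → P' y ≤ ε * ‖y‖ ^ 2)) :
    uncurry u =ᵐ[volume.restrict (Iio (0 : ℝ) ×ˢ (univ : Set (EuclideanSpace ℝ (Fin 3))))] 0 :=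
  have hA : ∀ a : ℝ, 0 < a → ENNReal.ofReal (a ^ (2 * ρ)) *
      cknA a (0 : ℝ × EuclideanSpace ℝ (Fin 3)) u ≤ (c : ℝ≥0∞) :=
    fun a ha => le_trans (le_trans le_self_add le_self_add) (hgauge a ha)
  ae_eq_zero_of_profile_eq_zero hρ.le hsw hH hgauge hu
    (profile_eq_zero_of_boundedBernoulliC2 hρ hρh hT₁ hTT₁ hsw.distributional hA hu hp hV hB)

end Summit.NavierStokesRegularity.NavierStokesRegularity.Theorems.PowerGaugeEulerLiouville.Past

end
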